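import Summits.QuantumFields.BalabanUV.T4Continuum.Spine.NE3.CurvedLandauGaugeStep
import Summits.QuantumFields.BalabanUV.T4Continuum.Spine.NE3.LandauCorrectionSupB8Flat
import Summits.QuantumFields.BalabanUV.T4Continuum.Support.NE3ResidualSliceRep
import HarnessLib

/-!
# T⁴ programme, node NE3 — [B8] AT A CURVED BACKGROUND, brick E′, letter 3′: ONE NEWTON STEP OF THE LANDAU SCHEME RELATIVE TO `W` —
# the Landau defect contracts, `‖Δ_Wλ′‖ ≤ c_R·Θ·‖Δ_Wλ‖`, `Θ = 4c₀M²(b + D) + 25·d·r·c₁M + 14·d·(c₁M)²D` (`CurvedLandauNewtonStep`)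

Cell `pub-balaban`, rung (B)+1 sub-cell t4, row NE3 (OWNER lineage `b2b-balaban-t4-ne3-p1`, generation 27; technique of record: implicit-function ∕
contraction mapping).  The CURVED twin of letter 3 `Spine/NE3/FlatLandauNewtonStep`: one Newton step of the (1.38)-Landau scheme RELATIVE TO an arbitrary
unitary periodic background `W` ([Balaban1985RegularSpaces] Sect. E (1.100) at `U₀ = W`), over letter 2b′ `CurvedLandauGaugeStep` and row NE3's
background-generic Landau letters (`LandauProjectionB8`, `LandauCorrectionSupB8Flat.sum_hsR_covDiv_add_covLapSite_eq_zero_of_isLandauB8`).  The sup letters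
(H0_W) `‖λ‖ ≤ c₀M²‖Δ_Wλ‖`, `‖D_Wλ‖ ≤ c₁M‖Δ_Wλ‖` on `N(Q′(W))` and (HR_W) `‖Δ_Wμ‖_∞ ≤ c_R‖F‖_∞` for `F + Δ_Wμ ⊥ Δ_WN(Q′(W))` are DISPLAYED HYPOTHESES
`hG`, `hR` (both PROVED in the tree for the multi-level small-field class with LEVEL-FREE constants: `SupRegularityCurvedUniform.supRegularity_uniform`,
`LandauProjectionSupCurvedUniform.covLapSite_sup_le_curved_uniform` — pub-balaban-gaps seat ne3, gens 8–10).

THE STEP.  Period `P = N·L^{j+1}`, `M = L^{j+1}`.  STATE `(u, λ)`: `u` unitary periodic, `V := U^{u}`, relative variables `R := W⁻¹V` with `‖R(b) − 1‖ ≤ r ≤ 1∕20`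
and `‖covDiv_W (log R)‖_∞ ≤ b`; `λ ∈ N(Q′(W))` with `log R + D_Wλ` (1.38)-Landau relative to `W` and `‖Δ_Wλ‖_∞ ≤ D`; regime `c₀M²D ≤ 1∕10`, `c₁MD ≤ 1∕25`.
STEP `u′ = e^{λ}u` and ANY `λ′ ∈ N(Q′(W))` with `log W⁻¹U^{u′} + D_Wλ′` (1.38)-Landau.  THEN `u′` unitary periodic, `‖W⁻¹U^{u′} − 1‖ ≤ r + (5∕4)c₁MD`,
`‖covDiv_W log W⁻¹U^{u′}‖_∞ ≤ b + D + D·Θ`, **`‖Δ_Wλ′‖_∞ ≤ c_R·D·Θ`**, `‖u′ − u‖ ≤ 2c₀M²D`.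

WHAT ([folklore]; `d ≥ 1`, `n : Type*` nonempty finite, `L ≥ 2`, `N ≥ 1`; 0 def, 0 sorry): §1 letters (periodicity ∕ skewness of the relative potential,
`covLapSite_skew`); §2 **`newton_step_W`**.

HONEST FRAMING (page 1): elementary lattice analysis of OUR objects at an arbitrary unitary periodic background; the (H0_W)∕(HR_W) letters are hypotheses BY
SHAPE; nothing of Bałaban's is used, asserted or discharged; brick E′ is NOT landed by this file; `PairLandauGaugeB8` ∕ NE3 ∕ NE7 NOT proved; spine PROVED
0∕9; finite T⁴ rung (B)+1 — NOT infinite volume, NOT mass gap, NOT `BetaPertH`, NOT Clay.  Continuum YM on T⁴ ⇐ BetaPertH ∧ nine spine estimates (0/9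
proved); BetaPertH ⇐ (D1) ∧ (D4) ∧ CAP+tail; G-an2-4 gates asym, D1 and NE2/3/4.  PLACEMENT: our lemma, `Spine/NE3/`.
-/

set_option autoImplicit false

open NormedSpace
open scoped BigOperators Matrix.Norms.L2Operator
open Finset

namespace Summit.QuantumFields.BalabanUV.T4Continuum.NE3.CurvedLandauNewtonStep

open Literature.MathematicalPhysics.QuantumFieldTheory.Balaban1983to89
open B7Prop1Explicit B7Prop2Explicit MatrixLog
open T4AveragingDeficitWall (Ad IsUnitaryCfg IsSkewDir)
open T4AveragingDeficitWallBoundary (IsPeriodicCfg periodBox)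
open AveragingDeficitPeriodicCounting (IsPeriodicDir)
open AveragingDeficitTransport (norm_Ad_of_unitary mem_U1_of_unitary)
open NE3EnergyShapes (IsUnitarySite IsPeriodicSite)
open NE3CovariantWeitzenbock (covDiv)
open NE3CurvedCornerGaugeSpace (covDiv_mem_skewAdjoint)
open NE3LandauOrbit (covDiv_add_period gaugeDir_skew)
open NE3CovariantCalculus (hsR hsR_sub_left)
open BlockAveragePushDirGauge (gaugeDir isPeriodicDir_gaugeDir)
open NE3.PairLandauB8 (avgKernelGauges IsLandauB8 covLapSite)
open NE3.LandauProjectionB8 (covDiv_gaugeDir_eq_covLapSite covLapSite_add_period)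
open NE3.LandauCorrectionSupB8Flat (sum_hsR_covDiv_add_covLapSite_eq_zero_of_isLandauB8)
open NE3.FlatLandauGaugeBond (expGauge_unitary norm_expGauge_sub_one_le mlog_mem_skewAdjoint_of_unitary)
open NE3.CurvedLandauGaugeStep (norm_covDiv_mlog_gaugeAct_sub_le_W gaugeAct_letters_W)

noncomputable section

variable {d : ℕ} {n : Type*} [Fintype n] [DecidableEq n]

/-! ## §1 Letters -/

/-- A unitary gauge transformation of a unitary configuration is unitary. [folklore] -/
theorem isUnitaryCfg_gaugeAct_W {u : Site d → (Matrix n n ℂ)ˣ} (hu : IsUnitarySite u) {U : Site d → Fin d → (Matrix n n ℂ)ˣ} (hU : IsUnitaryCfg U) :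
    IsUnitaryCfg (gaugeAct u U) := fun x μ =>
  (unitaryUnits (Matrix n n ℂ)).mul_mem ((unitaryUnits (Matrix n n ℂ)).mul_mem (hu x) (hU x μ)) ((unitaryUnits (Matrix n n ℂ)).inv_mem (hu _))

/-- The relative potential `log W⁻¹V` of periodic `W`, `V` is a periodic direction field. [folklore] -/
theorem isPeriodicDir_mlog_rel {W V : Site d → Fin d → (Matrix n n ℂ)ˣ} {P : ℤ} (hW : IsPeriodicCfg W P) (hV : IsPeriodicCfg V P) :
    IsPeriodicDir (fun y μ => mlog (((W y μ)⁻¹ * V y μ : (Matrix n n ℂ)ˣ) : Matrix n n ℂ)) P := fun x κ μ => by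
  show mlog (((W (x + P • e κ) μ)⁻¹ * V (x + P • e κ) μ : (Matrix n n ℂ)ˣ) : Matrix n n ℂ) = mlog (((W x μ)⁻¹ * V x μ : (Matrix n n ℂ)ˣ) : Matrix n n ℂ)
  rw [hW x κ μ, hV x κ μ]

/-- The relative potential of unitary `W`, `V` within `1∕4` of each other is a skew direction field. [folklore] -/
theorem isSkewDir_mlog_rel [Nonempty n] {W V : Site d → Fin d → (Matrix n n ℂ)ˣ} (hW : IsUnitaryCfg W) (hV : IsUnitaryCfg V)
    (h : ∀ (y : Site d) (μ : Fin d), ‖(((W y μ)⁻¹ * V y μ : (Matrix n n ℂ)ˣ) : Matrix n n ℂ) - 1‖ ≤ 1 / 4) :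
    IsSkewDir (fun y μ => mlog (((W y μ)⁻¹ * V y μ : (Matrix n n ℂ)ˣ) : Matrix n n ℂ)) := fun y μ =>
  mlog_mem_skewAdjoint_of_unitary ((unitaryUnits _).mul_mem ((unitaryUnits _).inv_mem (hW y μ)) (hV y μ)) (h y μ)

/-- `Δ_W λ` of a skew site field is skew for unitary `W` (`Δ_W = covDiv_W ∘ D_W`). [folklore] -/
theorem covLapSite_skew {W : Site d → Fin d → (Matrix n n ℂ)ˣ} (hW : IsUnitaryCfg W) {lam : Site d → Matrix n n ℂ}
    (hlam : ∀ y, lam y ∈ skewAdjoint (Matrix n n ℂ)) (y : Site d) : covLapSite W lam y ∈ skewAdjoint (Matrix n n ℂ) := by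
  rw [← congrFun (covDiv_gaugeDir_eq_covLapSite W lam) y]
  exact covDiv_mem_skewAdjoint hW (gaugeDir_skew hW hlam) y

/-! ## §2 One Newton step relative to `W` -/

/-- **ONE NEWTON STEP OF THE LANDAU SCHEME RELATIVE TO A UNITARY PERIODIC BACKGROUND `W`** (statement in the module docstring; every `d ≥ 1`, `L ≥ 2`,
`N ≥ 1`, level `j+1`; (H0_W) `hG`, (HR_W) `hR` as hypotheses with constants `c₀, c₁, c_R`). [folklore] -/
theorem newton_step_W [Nonempty n] (hd : 1 ≤ d) {L N : ℕ} (hL : 2 ≤ L) (hN : 1 ≤ N) (j : ℕ) {c₀ c₁ cR : ℝ}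
    {W : Site d → Fin d → (Matrix n n ℂ)ˣ} (hWu : IsUnitaryCfg W) (hWP : IsPeriodicCfg W ((N * L ^ (j + 1) : ℕ) : ℤ))
    (hG : ∀ mu ∈ avgKernelGauges (d := d) (n := n) L N (j + 1) W, ∀ B : ℝ,
      (∀ y : Site d, ‖covLapSite W mu y‖ ≤ B) →
        (∀ y : Site d, ‖mu y‖ ≤ c₀ * ((L : ℝ) ^ (j + 1)) ^ 2 * B) ∧
        (∀ (y : Site d) (μ : Fin d), ‖gaugeDir W mu y μ‖ ≤ c₁ * (L : ℝ) ^ (j + 1) * B))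
    (hR : ∀ (F : Site d → Matrix n n ℂ), (∀ y : Site d, F y ∈ skewAdjoint (Matrix n n ℂ)) →
      (∀ (y : Site d) (i : Fin d), F (y + ((N * L ^ (j + 1) : ℕ) : ℤ) • e i) = F y) →
      ∀ mu ∈ avgKernelGauges (d := d) (n := n) L N (j + 1) W,
        (∀ nu ∈ avgKernelGauges (d := d) (n := n) L N (j + 1) W,
          ∑ y ∈ periodBox (d := d) (N * L ^ (j + 1)), hsR (F y + covLapSite W mu y) (covLapSite W nu y) = 0) →
        ∀ B : ℝ, (∀ y : Site d, ‖F y‖ ≤ B) → ∀ y : Site d, ‖covLapSite W mu y‖ ≤ cR * B)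
    {U : Site d → Fin d → (Matrix n n ℂ)ˣ} (hUu : IsUnitaryCfg U) (hUP : IsPeriodicCfg U ((N * L ^ (j + 1) : ℕ) : ℤ))
    {u : Site d → (Matrix n n ℂ)ˣ} (huU : IsUnitarySite u) (huP : IsPeriodicSite u ((N * L ^ (j + 1) : ℕ) : ℤ))
    {r b D : ℝ} (hr : ∀ (y : Site d) (μ : Fin d), ‖(((W y μ)⁻¹ * gaugeAct u U y μ : (Matrix n n ℂ)ˣ) : Matrix n n ℂ) - 1‖ ≤ r) (hr1 : r ≤ 1 / 20)
    (hb : ∀ x : Site d, ‖covDiv W (fun y μ => mlog (((W y μ)⁻¹ * gaugeAct u U y μ : (Matrix n n ℂ)ˣ) : Matrix n n ℂ)) x‖ ≤ b)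
    {lam : Site d → Matrix n n ℂ} (hlam : lam ∈ avgKernelGauges (d := d) (n := n) L N (j + 1) W)
    (hLan : IsLandauB8 (d := d) L N (j + 1) W
      (fun y κ => mlog (((W y κ)⁻¹ * gaugeAct u U y κ : (Matrix n n ℂ)ˣ) : Matrix n n ℂ) + gaugeDir W lam y κ))
    (hD : ∀ y : Site d, ‖covLapSite W lam y‖ ≤ D)
    (hΛ1 : c₀ * ((L : ℝ) ^ (j + 1)) ^ 2 * D ≤ 1 / 10) (hγ1 : c₁ * (L : ℝ) ^ (j + 1) * D ≤ 1 / 25)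
    {u' : Site d → (Matrix n n ℂ)ˣ} (hu' : u' = fun y => expUnit (lam y) * u y)
    {lam' : Site d → Matrix n n ℂ} (hlam' : lam' ∈ avgKernelGauges (d := d) (n := n) L N (j + 1) W)
    (hLan' : IsLandauB8 (d := d) L N (j + 1) W
      (fun y κ => mlog (((W y κ)⁻¹ * gaugeAct u' U y κ : (Matrix n n ℂ)ˣ) : Matrix n n ℂ) + gaugeDir W lam' y κ)) :
    IsUnitarySite u' ∧ IsPeriodicSite u' ((N * L ^ (j + 1) : ℕ) : ℤ) ∧
    (∀ (y : Site d) (μ : Fin d), ‖(((W y μ)⁻¹ * gaugeAct u' U y μ : (Matrix n n ℂ)ˣ) : Matrix n n ℂ) - 1‖ ≤ r + 5 / 4 * (c₁ * (L : ℝ) ^ (j + 1) * D)) ∧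
    (∀ x : Site d, ‖covDiv W (fun y μ => mlog (((W y μ)⁻¹ * gaugeAct u' U y μ : (Matrix n n ℂ)ˣ) : Matrix n n ℂ)) x‖
      ≤ b + D + D * (4 * (c₀ * ((L : ℝ) ^ (j + 1)) ^ 2) * (b + D) + 25 * d * r * (c₁ * (L : ℝ) ^ (j + 1))
        + 14 * d * (c₁ * (L : ℝ) ^ (j + 1)) ^ 2 * D)) ∧
    (∀ y : Site d, ‖covLapSite W lam' y‖
      ≤ cR * (D * (4 * (c₀ * ((L : ℝ) ^ (j + 1)) ^ 2) * (b + D) + 25 * d * r * (c₁ * (L : ℝ) ^ (j + 1))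
        + 14 * d * (c₁ * (L : ℝ) ^ (j + 1)) ^ 2 * D))) ∧
    (∀ y : Site d, ‖(u' y : Matrix n n ℂ) - u y‖ ≤ 2 * (c₀ * ((L : ℝ) ^ (j + 1)) ^ 2 * D)) := by
  subst hu'
  set M : ℝ := (L : ℝ) ^ (j + 1) with hM
  have hL1 : 1 ≤ L := by omega
  have hP : 1 ≤ N * L ^ (j + 1) := Nat.mul_pos (by omega) (Nat.pow_pos (by omega))
  set Λ : ℝ := c₀ * M ^ 2 * D with hΛ_def
  set γ : ℝ := c₁ * M * D with hγ_def
  -- the current field and its letters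
  set V : Site d → Fin d → (Matrix n n ℂ)ˣ := gaugeAct u U with hV_def
  have hVu : IsUnitaryCfg V := isUnitaryCfg_gaugeAct_W huU hUu
  have hVP : IsPeriodicCfg V ((N * L ^ (j + 1) : ℕ) : ℤ) := NE3ResidualSliceRep.isPeriodicCfg_gaugeAct huP hUP
  have hZP : IsPeriodicDir (fun y μ => mlog (((W y μ)⁻¹ * V y μ : (Matrix n n ℂ)ˣ) : Matrix n n ℂ)) ((N * L ^ (j + 1) : ℕ) : ℤ) :=
    isPeriodicDir_mlog_rel hWP hVP
  have hZs : IsSkewDir (fun y μ => mlog (((W y μ)⁻¹ * V y μ : (Matrix n n ℂ)ˣ) : Matrix n n ℂ)) :=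
    isSkewDir_mlog_rel hWu hVu fun y μ => (hr y μ).trans (by linarith)
  -- the generator: skew, periodic; (H0_W)
  have hlams : ∀ y, lam y ∈ skewAdjoint (Matrix n n ℂ) := hlam.1
  have hlamP : ∀ (y : Site d) (i : Fin d), lam (y + ((N * L ^ (j + 1) : ℕ) : ℤ) • e i) = lam y := hlam.2.1
  obtain ⟨hΛ, hγ⟩ := hG lam hlam D hD
  have hΛle : Λ ≤ 1 / 10 := hΛ1
  have hγle : γ ≤ 1 / 25 := hγ1
  have hd' : 0 < d := hd
  have hΛ0 : 0 ≤ Λ := (norm_nonneg _).trans (hΛ 0)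
  have hγ0' : 0 ≤ γ := (norm_nonneg _).trans (hγ 0 ⟨0, hd'⟩)
  have hr0 : 0 ≤ r := (norm_nonneg _).trans (hr 0 ⟨0, hd'⟩)
  have hD0 : 0 ≤ D := (norm_nonneg _).trans (hD 0)
  have hb0 : 0 ≤ b := (norm_nonneg _).trans (hb 0)
  -- the new gauge `u′ = e^{λ}·u`
  set w : Site d → (Matrix n n ℂ)ˣ := fun y => expUnit (lam y) with hw_def
  have hw : ∀ y, (w y : Matrix n n ℂ) = exp (lam y) := fun y => rfl
  have hwU : IsUnitarySite w := expGauge_unitary hlams hw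
  have hwP : IsPeriodicSite w ((N * L ^ (j + 1) : ℕ) : ℤ) := fun y i => by simp only [hw_def, hlamP y i]
  have hprod : (fun y => expUnit (lam y) * u y) = w * u := rfl
  have hact : gaugeAct (fun y => expUnit (lam y) * u y) U = gaugeAct w V := by
    rw [hprod, B8Eq115GaugeFixing.gaugeAct_mul]
  have hu'U : IsUnitarySite (fun y => expUnit (lam y) * u y) := fun y => (unitaryUnits (Matrix n n ℂ)).mul_mem (hwU y) (huU y)
  have hu'P : IsPeriodicSite (fun y => expUnit (lam y) * u y) ((N * L ^ (j + 1) : ℕ) : ℤ) := fun y i => by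
    show expUnit (lam (y + ((N * L ^ (j + 1) : ℕ) : ℤ) • e i)) * u (y + ((N * L ^ (j + 1) : ℕ) : ℤ) • e i) = expUnit (lam y) * u y
    rw [hlamP y i, huP y i]
  -- letter 2b′
  have hlet : ∀ (y : Site d) (μ : Fin d), ‖(((W y μ)⁻¹ * gaugeAct w V y μ : (Matrix n n ℂ)ˣ) : Matrix n n ℂ) - 1‖ ≤ r + 5 / 4 * γ ∧
      ‖mlog (((W y μ)⁻¹ * gaugeAct w V y μ : (Matrix n n ℂ)ˣ) : Matrix n n ℂ)‖ ≤ 2 * (r + 5 / 4 * γ) ∧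
      mlog (((W y μ)⁻¹ * gaugeAct w V y μ : (Matrix n n ℂ)ˣ) : Matrix n n ℂ) ∈ skewAdjoint (Matrix n n ℂ) ∧
      ((W y μ)⁻¹ * gaugeAct w V y μ : (Matrix n n ℂ)ˣ) ∈ unitaryUnits (Matrix n n ℂ) := fun y μ =>
    gaugeAct_letters_W hWu hVu hr hr1 hlams hΛ hΛle hγ hγle hw y μ
  have hJ : ∀ x : Site d, ‖covDiv W (fun y μ => mlog (((W y μ)⁻¹ * gaugeAct w V y μ : (Matrix n n ℂ)ˣ) : Matrix n n ℂ)) x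
      - covDiv W (fun y μ => mlog (((W y μ)⁻¹ * V y μ : (Matrix n n ℂ)ˣ) : Matrix n n ℂ)) x - covLapSite W lam x‖
      ≤ D * (4 * (c₀ * M ^ 2) * (b + D) + 25 * d * r * (c₁ * M) + 14 * d * (c₁ * M) ^ 2 * D) := by
    intro x
    have h := norm_covDiv_mlog_gaugeAct_sub_le_W hWu hVu hr hr1 hlams hΛ hΛle hγ hγle hw x
    have h2 : 4 * Λ * (‖covDiv W (fun y μ => mlog (((W y μ)⁻¹ * V y μ : (Matrix n n ℂ)ˣ) : Matrix n n ℂ)) x‖ + ‖covLapSite W lam x‖)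
        + 25 * d * r * γ + 14 * d * γ ^ 2 ≤ 4 * Λ * (b + D) + 25 * d * r * γ + 14 * d * γ ^ 2 := by
      gcongr
      · exact hb x
      · exact hD x
    refine (h.trans h2).trans (le_of_eq ?_)
    simp only [hΛ_def, hγ_def]; ring
  -- the new relative potential: periodic, skew
  have hV'P : IsPeriodicCfg (gaugeAct w V) ((N * L ^ (j + 1) : ℕ) : ℤ) := NE3ResidualSliceRep.isPeriodicCfg_gaugeAct hwP hVP
  have hZ'P : IsPeriodicDir (fun y μ => mlog (((W y μ)⁻¹ * gaugeAct w V y μ : (Matrix n n ℂ)ˣ) : Matrix n n ℂ)) ((N * L ^ (j + 1) : ℕ) : ℤ) :=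
    isPeriodicDir_mlog_rel hWP hV'P
  have hZ's : IsSkewDir (fun y μ => mlog (((W y μ)⁻¹ * gaugeAct w V y μ : (Matrix n n ℂ)ˣ) : Matrix n n ℂ)) := fun y μ => (hlet y μ).2.2.1
  -- (HR_W) on the junk `J`
  have hlam'P : ∀ (y : Site d) (i : Fin d), lam' (y + ((N * L ^ (j + 1) : ℕ) : ℤ) • e i) = lam' y := hlam'.2.1
  rw [hact] at hLan'
  set J : Site d → Matrix n n ℂ := fun x => covDiv W (fun y μ => mlog (((W y μ)⁻¹ * gaugeAct w V y μ : (Matrix n n ℂ)ˣ) : Matrix n n ℂ)) x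
      - covDiv W (fun y μ => mlog (((W y μ)⁻¹ * V y μ : (Matrix n n ℂ)ˣ) : Matrix n n ℂ)) x - covLapSite W lam x with hJ_def
  have hJs : ∀ y, J y ∈ skewAdjoint (Matrix n n ℂ) := fun y =>
    (skewAdjoint (Matrix n n ℂ)).sub_mem ((skewAdjoint (Matrix n n ℂ)).sub_mem (covDiv_mem_skewAdjoint hWu hZ's y)
      (covDiv_mem_skewAdjoint hWu hZs y)) (covLapSite_skew hWu hlams y)
  have hJP : ∀ (y : Site d) (i : Fin d), J (y + ((N * L ^ (j + 1) : ℕ) : ℤ) • e i) = J y := fun y i => by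
    simp only [hJ_def, covDiv_add_period hWP hZ'P, covDiv_add_period hWP hZP, covLapSite_add_period hWP hlamP]
  have horth : ∀ nu ∈ avgKernelGauges (d := d) (n := n) L N (j + 1) W,
      ∑ y ∈ periodBox (d := d) (N * L ^ (j + 1)), hsR (J y + covLapSite W lam' y) (covLapSite W nu y) = 0 := by
    intro nu hnu
    have E1 := sum_hsR_covDiv_add_covLapSite_eq_zero_of_isLandauB8 hP hWu hWP hZ'P hlam'P hLan' hnu
    have E0 := sum_hsR_covDiv_add_covLapSite_eq_zero_of_isLandauB8 hP hWu hWP hZP hlamP hLan hnu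
    have hpt : ∀ y : Site d, J y + covLapSite W lam' y
        = (covDiv W (fun y μ => mlog (((W y μ)⁻¹ * gaugeAct w V y μ : (Matrix n n ℂ)ˣ) : Matrix n n ℂ)) y + covLapSite W lam' y)
          - (covDiv W (fun y μ => mlog (((W y μ)⁻¹ * V y μ : (Matrix n n ℂ)ˣ) : Matrix n n ℂ)) y + covLapSite W lam y) := fun y => by
      simp only [hJ_def]; abel
    simp_rw [hpt, hsR_sub_left, Finset.sum_sub_distrib, E1, E0, sub_zero]
  have hD' : ∀ y : Site d, ‖covLapSite W lam' y‖
      ≤ cR * (D * (4 * (c₀ * M ^ 2) * (b + D) + 25 * d * r * (c₁ * M) + 14 * d * (c₁ * M) ^ 2 * D)) :=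
    hR J hJs hJP lam' hlam' horth _ hJ
  refine ⟨hu'U, hu'P, ?_, ?_, hD', ?_⟩
  · intro y μ
    rw [hact]
    exact (hlet y μ).1
  · intro x
    rw [hact]
    have hid : covDiv W (fun y μ => mlog (((W y μ)⁻¹ * gaugeAct w V y μ : (Matrix n n ℂ)ˣ) : Matrix n n ℂ)) x
        = covDiv W (fun y μ => mlog (((W y μ)⁻¹ * V y μ : (Matrix n n ℂ)ˣ) : Matrix n n ℂ)) x + covLapSite W lam x + J x := by
      simp only [hJ_def]; abel
    rw [hid]
    calc _ ≤ ‖covDiv W (fun y μ => mlog (((W y μ)⁻¹ * V y μ : (Matrix n n ℂ)ˣ) : Matrix n n ℂ)) x‖ + ‖covLapSite W lam x‖ + ‖J x‖ := norm_add₃_le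
      _ ≤ b + D + D * (4 * (c₀ * M ^ 2) * (b + D) + 25 * d * r * (c₁ * M) + 14 * d * (c₁ * M) ^ 2 * D) :=
          add_le_add (add_le_add (hb x) (hD x)) (hJ x)
  · intro y
    have h1 : ((expUnit (lam y) * u y : (Matrix n n ℂ)ˣ) : Matrix n n ℂ) - u y = (exp (lam y) - 1) * (u y : Matrix n n ℂ) := by
      rw [Units.val_mul, val_expUnit, sub_mul, one_mul]
    have hu1 : ‖(u y : Matrix n n ℂ)‖ = 1 := CStarRing.norm_of_mem_unitary (mem_unitaryUnits.mp (huU y))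
    rw [h1]
    calc _ ≤ ‖exp (lam y) - 1‖ * ‖(u y : Matrix n n ℂ)‖ := norm_mul_le _ _
      _ ≤ 2 * Λ * 1 := by
          rw [hu1]
          exact mul_le_mul_of_nonneg_right ((hw y) ▸ norm_expGauge_sub_one_le hw hΛ (by linarith) y) zero_le_one
      _ = 2 * (c₀ * M ^ 2 * D) := by rw [hΛ_def]; ring

end

end Summit.QuantumFields.BalabanUV.T4Continuum.NE3.CurvedLandauNewtonStep
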